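import Mathlib
import HarnessLib
import Summits.NavierStokesRegularity.NavierStokesRegularity.Theorems.PoloidalWindowRigidity.Negative.CriticalStrainTight

/-!
# Crux `PoloidalWindowRigidity` (K2, stmt-NavierStokesRegularity-19708) — negative side:
# the rev-10 residue clause (vii) «super-critical production at near-record vorticity» CUTS the drifting witness,
# and the near-peak exclusion p484908 is tight without the Oseen-mild identity

Negative-side support (refuter seat ns-regularity-refuter1 gen 2, cell ns-regularity-ideate; D-0081 §C), K-read of
skeleton rev 10 (`stub_residueSupercriticalNearPeak`, lead ns-poloidal-K2-p1 g2) and of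
`…Theorems.PoloidalWindowDoorPoloidalWindowRigidityNearPeakCriticalProduction` (p484908, seat nsreg-p7 g5).

* `curl_driftProfile_neg_one_peak` — the drifting profile `w = driftProfile` has `|ω(−1, (0,0,π/2))|² = 8 ≠ 0`;
* `driftProfile_not_nearPeakSupercritical` — clause (vii) of rev 10,
  «`∀ θ ≥ 0, ∀ (s₀,y₀)` with `θ < (−s₀)²|ω|²`, `∃ (s,y)` with `θ < (−s)²|ω|²` and `|ω|² < (−s)⟪ω, Dv ω⟫`»,
  is FALSE for `v = w`: the production of `w` is at most critical everywhere
  (`driftProfile_production_le`, file `CriticalStrainTight`), so already `θ = 0` has no witness point.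
  Hence (vii) is NOT weightless against the standing witness of the negative lane (contrary to the rev-10
  registration note «(v)–(vii) are weightless vs the drift witness by construction»): the certificate
  «residue stub with (M) ↦ ClassRates is false» (p475628 for rev 8) does NOT transport to rev 10 through `w`
  (nor through any amplitude multiple `μ•w`: near-record points of `(−s)²|ω_μ|² = 4μ² sin² z₂ (cos² z₀ + cos² z₁)`
  have `cos z₂ → 0`, where the production ratio `μ(−cos z₂)(…) → 0` — paper remark, not kernel-checked here).
* `critEnstrophyAbove_false_with_classRates_without_mild` — p484908
  `critEnstrophy_le_of_critical_production_above` with the Oseen-mild identity (M) REPLACED by the scale-sharp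
  `ClassRate` bounds (and poloidality + the frozen constraint added) is FALSE: `θ = 0`, the drifting profile
  (`C = 4, C₁ = 8, C₂ = 4`), the point `(−1, (0,0,π/2))`.  So (M) is load-bearing in p484908.

WHAT THIS IS NOT: not a claim about Navier–Stokes — kinematics of an explicit profile; and NOT a certificate that
the rev-10 stub is false without (M): that question is OPEN on the negative side (a three-wave poloidal frozen
profile with super-critical production at its vorticity record is the candidate, separate file). [folklore]
-/

noncomputable section

-- the summit and its single sub-problem share the name (CONVENTIONS §1), as in every Theorems file
set_option linter.dupNamespace false

namespace Summit.NavierStokesRegularity.NavierStokesRegularity.Theorems.PoloidalWindowRigidity.Negative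

open Set Function
open scoped RealInnerProductSpace InnerProductSpace
open Literature.Analysis Literature.Analysis.FluidPDE

/-- At `t = −1`, `y = (0, 0, π/2)` the vorticity of the drifting profile is `(2, −2, 0)`: `|ω|² = 8`. [folklore] -/
theorem curl_driftProfile_neg_one_peak :
    ⟪curl (driftProfile (-1)) ((Real.pi / 2) • EuclideanSpace.single 2 (1 : ℝ)),
      curl (driftProfile (-1)) ((Real.pi / 2) • EuclideanSpace.single 2 (1 : ℝ))⟫_ℝ = 8 := by
  rw [Literature.Algebra.EuclideanLattices.inner_fin_three, curl_driftProfile_apply_zero,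
    curl_driftProfile_apply_one, curl_driftProfile_apply_two, driftShift_neg_one]
  simp [cellAmp]
  norm_num

/-- **Clause (vii) of skeleton rev 10 («super-critical production at near-record vorticity») FAILS for the
drifting profile**: its production never exceeds the critical rate, so no level `θ ≥ 0` below the (positive)
scale-invariant enstrophy has a super-critical point above it. [folklore] -/
theorem driftProfile_not_nearPeakSupercritical :
    ¬ (∀ θ : ℝ, 0 ≤ θ → ∀ s₀ < 0, ∀ y₀ : EuclideanSpace ℝ (Fin 3),
        θ < (-s₀) ^ 2 * ⟪curl (driftProfile s₀) y₀, curl (driftProfile s₀) y₀⟫_ℝ →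
        ∃ s < 0, ∃ y : EuclideanSpace ℝ (Fin 3),
          θ < (-s) ^ 2 * ⟪curl (driftProfile s) y, curl (driftProfile s) y⟫_ℝ ∧
          ⟪curl (driftProfile s) y, curl (driftProfile s) y⟫_ℝ <
            (-s) * ⟪curl (driftProfile s) y, fderiv ℝ (driftProfile s) y (curl (driftProfile s) y)⟫_ℝ) := by
  intro h
  have h8 : (0 : ℝ) < (-(-1 : ℝ)) ^ 2 * ⟪curl (driftProfile (-1)) ((Real.pi / 2) • EuclideanSpace.single 2 (1 : ℝ)),
      curl (driftProfile (-1)) ((Real.pi / 2) • EuclideanSpace.single 2 (1 : ℝ))⟫_ℝ := by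
    rw [curl_driftProfile_neg_one_peak]; norm_num
  obtain ⟨s, hs, y, -, hlt⟩ := h 0 le_rfl (-1) (by norm_num) _ h8
  exact absurd (driftProfile_production_le hs y) (not_le.2 hlt)

/-- **p484908 without (M) is FALSE.** `critEnstrophy_le_of_critical_production_above` — Type-I rate, joint continuity,
divergence-free slices, «production at most critical wherever `(−s)²|ω|² > θ`» ⇒ «`(−s)²|ω|² ≤ θ` everywhere» — with
the Oseen-mild identity REPLACED by the `ClassRate` bounds `‖Dv‖ ≤ C₁/(−t)`, `‖curl v‖ ≤ C₂/(−t)`, poloidality and the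
frozen constraint ADDED, fails: `θ = 0` and the drifting profile (`C = 4, C₁ = 8, C₂ = 4`), whose production is at most
critical everywhere while `|ω(−1,(0,0,π/2))|² = 8 > 0`. [folklore] -/
theorem critEnstrophyAbove_false_with_classRates_without_mild :
    ¬ (∀ (C C₁ C₂ : ℝ) (v : ℝ → EuclideanSpace ℝ (Fin 3) → EuclideanSpace ℝ (Fin 3)),
      Literature.Analysis.FluidPDE.HasTypeITimeDecay C v →
      ContinuousOn (Function.uncurry v) (Set.Iio (0 : ℝ) ×ˢ Set.univ) →
      (∀ t < 0, ∀ y, ‖fderiv ℝ (v t) y‖ ≤ C₁ / (-t)) →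
      (∀ t < 0, ∀ y, ‖Literature.Analysis.FluidPDE.curl (v t) y‖ ≤ C₂ / (-t)) →
      (∀ t < 0, Literature.Analysis.FluidPDE.VectorCalculus.IsDivFree (v t)) →
      (∀ s < 0, ∀ y, ⟪Literature.Analysis.FluidPDE.curl (v s) y, EuclideanSpace.single 2 (1 : ℝ)⟫_ℝ = 0) →
      (∀ s < 0, ∀ y, ⟪fderiv ℝ (v s) y (Literature.Analysis.FluidPDE.curl (v s) y), EuclideanSpace.single 2 (1 : ℝ)⟫_ℝ = 0) →
      ∀ θ : ℝ, 0 ≤ θ →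
      (∀ s < 0, ∀ y, θ < (-s) ^ 2 * ⟪Literature.Analysis.FluidPDE.curl (v s) y, Literature.Analysis.FluidPDE.curl (v s) y⟫_ℝ →
        (-s) * ⟪Literature.Analysis.FluidPDE.curl (v s) y,
            fderiv ℝ (v s) y (Literature.Analysis.FluidPDE.curl (v s) y)⟫_ℝ ≤
          ⟪Literature.Analysis.FluidPDE.curl (v s) y, Literature.Analysis.FluidPDE.curl (v s) y⟫_ℝ) →
      ∀ s < 0, ∀ y, (-s) ^ 2 * ⟪Literature.Analysis.FluidPDE.curl (v s) y, Literature.Analysis.FluidPDE.curl (v s) y⟫_ℝ ≤ θ) := by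
  intro h
  have h1 := h 4 8 4 driftProfile hasTypeITimeDecay_driftProfile continuousOn_driftProfile
    (fun t ht y => norm_fderiv_driftProfile_le ht y) (fun t ht y => norm_curl_driftProfile_le ht y)
    (fun t _ => isDivFree_driftProfile t) (fun s _ y => poloidal_driftProfile s y)
    (fun s _ y => frozen_driftProfile s y) 0 le_rfl (fun s hs y _ => driftProfile_production_le hs y)
    (-1) (by norm_num) ((Real.pi / 2) • EuclideanSpace.single 2 (1 : ℝ))
  rw [curl_driftProfile_neg_one_peak] at h1
  norm_num at h1

end Summit.NavierStokesRegularity.NavierStokesRegularity.Theorems.PoloidalWindowRigidity.Negative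

end
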